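import Summits.BirchSwinnertonDyer.BirchSwinnertonDyer.Theorems.PrintX10bBeyondCarrierCoprimeFrames
import Summits.BirchSwinnertonDyer.BirchSwinnertonDyer.Theses.PrintX10b
import HarnessLib

/-!
# Crux `BeyondCarrierDepthX10b` (stmt-BirchSwinnertonDyer-23055, `route-BirchSwinnertonDyer-PrintX10b`
# rev 18) BY NAME from the five named facts of the Howard road and its ONE open registered stub
# `stub_beyondCarrier_divisibleClassNumber` (the residual frames `3 ∣ h_K`) — the residual of record,
# kernel-checked

HONEST FRAMING (cell `run/shared/lean/pub/bsd-f3-mu/`, idle lead seat p1 serving the PrintX10b pen's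
BC3 ask of 2026-08-27T22:31:20Z): THEOREMS ONLY, nothing booked, the crux is NOT closed. This file is
the registered birth skeleton's composition `BeyondCarrierDepthX10b_of` (plan g3, BC3 2026-08-27T22:30:37Z;
case split on `3 ∣ h_K`, bound `max B₁ B₂`) with the Howard-frames stub REPLACED by the landed helper
`HowardFrames.stub_beyondCarrier_coprimeClassNumber_of_namedFacts` (p581299), so that what remains of
the crux is stated in the kernel, by name: the five named facts `h46` (Mastella–Zerman 2026 Cor. 4.6),
`hYZ` (Yan–Zhu/BCS/CGLS composite, fed from singles at a leaf), `h331` (JSW 2017 Thm. 3.3.1), `hChaL`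
(Cha 2005 Rmk. 25 lower half), `hKo` (Kolyvagin 1990 Thm. A) AND the residual-frames stub
(`3 ∣ h_K`: no mechanism in print — Howard's/Mastella–Zerman's Kolyvagin-system argument assumes
`p ∤ h_K`, Jetchev 2008 assumes surjective image). BSD is not proved by any of this.

* `beyondCarrierDepthX10b_of_frames` — the skeleton's composition, sorry-free, both registered stubs as
  HYPOTHESES (names distinct from the skeleton's, so the eventual closer can land the skeleton verbatim).
* `beyondCarrierDepthX10b_of_namedFacts_of_residualFrames` — the crux from the five facts + the residual stub.

References: [MastellaZerman2026] Cor. 4.6; [YanZhu2024MainConjNonCM] Thm. 5.7 (1), 5.9;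
[JetchevSkinnerWan2017] Thm. 3.3.1; [Cha2005] Rmk. 25; [Kolyvagin1990] Thm. A; [Jetchev2008] Thm. 1.4;
route file `Theses/PrintX10b.lean` (rev 18, item 23055).
-/

-- the REGISTERED stub namespace `Summit.BirchSwinnertonDyer.BirchSwinnertonDyer.Cruxes.…` repeats the summit name
set_option linter.dupNamespace false
set_option autoImplicit false

noncomputable section

open WeierstrassCurve NumberField
  Literature.NumberTheory.EllipticCurves Literature.NumberTheory.EllipticCurves.ModularForms
  Literature.NumberTheory.EllipticCurves.JetchevSkinnerWan2017
  Literature.NumberTheory.EllipticCurves.YanZhu2026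
  Summit.BirchSwinnertonDyer.BirchSwinnertonDyer.Theses.PrintX10b

open Literature.NumberTheory.EllipticCurves.Rank1Residual (ClassX10 Surj)

namespace Summit.BirchSwinnertonDyer.BirchSwinnertonDyer.Cruxes.BeyondCarrierDepthX10b.HowardFrames

/-- **The birth skeleton's composition, sorry-free: crux `BeyondCarrierDepthX10b` (item 23055) from its two
registered stubs taken as HYPOTHESES** — `h₁` = `stub_beyondCarrier_coprimeClassNumber` (Howard frames,
`¬ p ∣ h_K`) and `h₂` = `stub_beyondCarrier_divisibleClassNumber` (residual frames, `p ∣ h_K`), signatures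
VERBATIM; the two frame classes exhaust the Heegner frames, bound `max B₁ B₂`. (Same term as the skeleton's
`BeyondCarrierDepthX10b_of`; a distinct name so the closer can land the skeleton file unchanged.)
[cite: Jetchev2008, Conj. 1.3 and Thm. 1.4] -/
theorem beyondCarrierDepthX10b_of_frames
    (h₁ : ∀ (W : WeierstrassCurve ℚ) [W.IsElliptic] [W.IsGloballyMinimal] [NeZero (W.conductorNorm ℤ)] (p : ℕ) [Fact p.Prime], Literature.NumberTheory.EllipticCurves.Rank1Residual.ClassX10 W p → ¬ Literature.NumberTheory.EllipticCurves.Rank1Residual.Surj W 3 → ¬ W.HasCM → W.analyticRank = 1 → ∃ B : ℕ, ∀ (K : Type) [Field K] [NumberField K] (Dt : Literature.NumberTheory.EllipticCurves.ModularForms.ModularParametrizationData W (W.conductorNorm ℤ)) (β : ℤ) (ι : K →+* ℂ), Literature.NumberTheory.EllipticCurves.IsImaginaryQuadratic K → B < (NumberField.discr K).natAbs → NumberField.discr K % 8 = 1 → Literature.NumberTheory.EllipticCurves.SatisfiesHeegnerHypothesis (W.conductorNorm ℤ) K → Literature.NumberTheory.EllipticCurves.SatisfiesHeegnerHypothesis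 p K → ¬ p ∣ NumberField.classNumber K → (4 * (W.conductorNorm ℤ : ℤ)) ∣ β ^ 2 - NumberField.discr K → ¬ (p : ℤ) ∣ Dt.c → ∀ (d₁ : Literature.NumberTheory.EllipticCurves.KolyvaginHeegnerData Dt β ι 1), ¬ IsOfFinAddOrder d₁.derivedPoint → ∀ (s : ℕ), (∀ (q : ℕ) [Fact q.Prime], q ∣ W.conductorNorm ℤ → padicValNat p ((W.baseChange ℚ_[q]).localTamagawaNumber ℤ_[q]) < s) → s ≤ padicValNat p W.tamagawaProduct → ∀ (n : ℕ) (d : Literature.NumberTheory.EllipticCurves.KolyvaginHeegnerData Dt β ι n), Squarefree n → (∀ ℓ ∈ n.primeFactors, Literature.NumberTheory.EllipticCurves.Zhang2014.IsKolyvaginPrime (W.conductorNorm ℤ) W K p ℓ ∧ s ≤ Literature.NumberTheory.EllipticCurves.Zhang2014.kolyvaginIndex W p ℓ) → ∃ Q : (W.baseChange (Literature.NumberTheory.EllipticCurves.ringClassField K ι n)).toAffine.Point, ((p ^ s : ℕ) : ℤ) • Q = d.derivedPoint)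
    (h₂ : ∀ (W : WeierstrassCurve ℚ) [W.IsElliptic] [W.IsGloballyMinimal] [NeZero (W.conductorNorm ℤ)] (p : ℕ) [Fact p.Prime], Literature.NumberTheory.EllipticCurves.Rank1Residual.ClassX10 W p → ¬ Literature.NumberTheory.EllipticCurves.Rank1Residual.Surj W 3 → ¬ W.HasCM → W.analyticRank = 1 → ∃ B : ℕ, ∀ (K : Type) [Field K] [NumberField K] (Dt : Literature.NumberTheory.EllipticCurves.ModularForms.ModularParametrizationData W (W.conductorNorm ℤ)) (β : ℤ) (ι : K →+* ℂ), Literature.NumberTheory.EllipticCurves.IsImaginaryQuadratic K → B < (NumberField.discr K).natAbs → NumberField.discr K % 8 = 1 → Literature.NumberTheory.EllipticCurves.SatisfiesHeegnerHypothesis (W.conductorNorm ℤ) K → Literature.NumberTheory.EllipticCurves.SatisfiesHeegnerHypothesis p K → p ∣ NumberField.classNumber K → (4 * (W.conductorNorm ℤ : ℤ)) ∣ β ^ 2 - NumberField.discr K → ¬ (p : ℤ) ∣ Dt.c → ∀ (d₁ : Literature.NumberTheory.EllipticCurves.KolyvaginHeegnerData Dt β ι 1), ¬ IsOfFinAddOrder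 d₁.derivedPoint → ∀ (s : ℕ), (∀ (q : ℕ) [Fact q.Prime], q ∣ W.conductorNorm ℤ → padicValNat p ((W.baseChange ℚ_[q]).localTamagawaNumber ℤ_[q]) < s) → s ≤ padicValNat p W.tamagawaProduct → ∀ (n : ℕ) (d : Literature.NumberTheory.EllipticCurves.KolyvaginHeegnerData Dt β ι n), Squarefree n → (∀ ℓ ∈ n.primeFactors, Literature.NumberTheory.EllipticCurves.Zhang2014.IsKolyvaginPrime (W.conductorNorm ℤ) W K p ℓ ∧ s ≤ Literature.NumberTheory.EllipticCurves.Zhang2014.kolyvaginIndex W p ℓ) → ∃ Q : (W.baseChange (Literature.NumberTheory.EllipticCurves.ringClassField K ι n)).toAffine.Point, ((p ^ s : ℕ) : ℤ) • Q = d.derivedPoint) :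
    BeyondCarrierDepthX10b := by
  intro W _ _ _ p _ hX hns hcm hr
  obtain ⟨B₁, h₁⟩ := h₁ W p hX hns hcm hr
  obtain ⟨B₂, h₂⟩ := h₂ W p hX hns hcm hr
  refine ⟨max B₁ B₂, ?_⟩
  intro K _ _ Dt β ι hK hB hd8 hHN hHp hβ hc d₁ hd₁ s hcar hs n d hn hℓ
  by_cases hh : p ∣ NumberField.classNumber K
  · exact h₂ K Dt β ι hK (lt_of_le_of_lt (le_max_right B₁ B₂) hB) hd8 hHN hHp hh hβ hc d₁ hd₁ s hcar hs
      n d hn hℓ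
  · exact h₁ K Dt β ι hK (lt_of_le_of_lt (le_max_left B₁ B₂) hB) hd8 hHN hHp hh hβ hc d₁ hd₁ s hcar hs
      n d hn hℓ

/-- **Crux `BeyondCarrierDepthX10b` (item 23055) BY NAME from the five named facts of the Howard road and the
ONE open registered stub — the residual of record.** Hypotheses: `h46` Mastella–Zerman 2026 Cor. 4.6, `hYZ`
the Yan–Zhu/BCS/CGLS composite, `h331` JSW 2017 Thm. 3.3.1, `hChaL` Cha 2005 Rmk. 25 (lower half), `hKo`
Kolyvagin 1990 Thm. A, and `hres` = `stub_beyondCarrier_divisibleClassNumber` VERBATIM (beyond-carrier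
`3^s`-divisibility of the derived Heegner points on the rev-3b X10b frames with `3 ∣ h_K` — OPEN, no printed
mechanism). Composition of `beyondCarrierDepthX10b_of_frames` with the landed Howard-frames helper
`stub_beyondCarrier_coprimeClassNumber_of_namedFacts` (p581299, via p577630).
[cite: MastellaZerman2026, Cor. 4.6] [cite: YanZhu2024MainConjNonCM, Thm. 5.7 (1), Thm. 5.9]
[cite: JetchevSkinnerWan2017, Thm. 3.3.1] [cite: Cha2005, Thm. 21 and Rmk. 25] [cite: Kolyvagin1990, Thm. A] -/
theorem beyondCarrierDepthX10b_of_namedFacts_of_residualFrames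
    (h46 : MastellaZerman2026.cor46_howardDivisibility_of_scalarImage.{0})
    (hYZ : thm57_thm59_bcs422_cgls513_generator_constantCoeff_of_heegnerDivisibility)
    (h331 : thm331_anticyclotomicControl)
    (hChaL : Cha2005.rmk25_pow_dvd_card_sha_primary_of_certificate)
    (hKo : ∀ (N : ℕ) [NeZero N] (W : WeierstrassCurve ℚ) (K : Type) [Field K] [NumberField K],
      kolyvagin N W K)
    (hres : ∀ (W : WeierstrassCurve ℚ) [W.IsElliptic] [W.IsGloballyMinimal] [NeZero (W.conductorNorm ℤ)] (p : ℕ) [Fact p.Prime], Literature.NumberTheory.EllipticCurves.Rank1Residual.ClassX10 W p → ¬ Literature.NumberTheory.EllipticCurves.Rank1Residual.Surj W 3 → ¬ W.HasCM → W.analyticRank = 1 → ∃ B : ℕ, ∀ (K : Type) [Field K] [NumberField K] (Dt : Literature.NumberTheory.EllipticCurves.ModularForms.ModularParametrizationData W (W.conductorNorm ℤ)) (β : ℤ) (ι : K →+* ℂ), Literature.NumberTheory.EllipticCurves.IsImaginaryQuadratic K → B < (NumberField.discr K).natAbs → NumberField.discr K % 8 = 1 → Literature.NumberTheory.EllipticCurves.SatisfiesHeegnerHypothesis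 (W.conductorNorm ℤ) K → Literature.NumberTheory.EllipticCurves.SatisfiesHeegnerHypothesis p K → p ∣ NumberField.classNumber K → (4 * (W.conductorNorm ℤ : ℤ)) ∣ β ^ 2 - NumberField.discr K → ¬ (p : ℤ) ∣ Dt.c → ∀ (d₁ : Literature.NumberTheory.EllipticCurves.KolyvaginHeegnerData Dt β ι 1), ¬ IsOfFinAddOrder d₁.derivedPoint → ∀ (s : ℕ), (∀ (q : ℕ) [Fact q.Prime], q ∣ W.conductorNorm ℤ → padicValNat p ((W.baseChange ℚ_[q]).localTamagawaNumber ℤ_[q]) < s) → s ≤ padicValNat p W.tamagawaProduct → ∀ (n : ℕ) (d : Literature.NumberTheory.EllipticCurves.KolyvaginHeegnerData Dt β ι n), Squarefree n → (∀ ℓ ∈ n.primeFactors, Literature.NumberTheory.EllipticCurves.Zhang2014.IsKolyvaginPrime (W.conductorNorm ℤ) W K p ℓ ∧ s ≤ Literature.NumberTheory.EllipticCurves.Zhang2014.kolyvaginIndex W p ℓ) → ∃ Q : (W.baseChange (Literature.NumberTheory.EllipticCurves.ringClassField K ι n)).toAffine.Point, ((p ^ s : ℕ) : ℤ) • Q =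 d.derivedPoint) :
    BeyondCarrierDepthX10b :=
  beyondCarrierDepthX10b_of_frames
    (stub_beyondCarrier_coprimeClassNumber_of_namedFacts h46 hYZ h331 hChaL hKo) hres

end Summit.BirchSwinnertonDyer.BirchSwinnertonDyer.Cruxes.BeyondCarrierDepthX10b.HowardFrames

end
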